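import Summits.QuantumFields.YangMills.Theses.UnitScaleTilt
import Literature.MathematicalPhysics.QuantumFieldTheory.Balaban1983to89.T3PrintedRegularMinimiserReduction

/-!
# Route `UnitScaleTilt` — crux K1 `UnitTilt` (stmt-QuantumFields-18915) FROM THE TWINS AT PRINT'S REGULAR SPACE IN FULL: the glue of the
# re-based split `UnitTilt ⇐ MinimiserStabilityRegPr ∧ FluctuationComparisonRegPr` (support file; K1 and its children stay open)

Cell `ym3-torus` (HUMAN RULING D-0037, YM ladder rung R3), seat `ym3-torus-p1` gen 5; cell record HOME/UV3-NODE.md §12 (finding F-g5-1: the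
tree's `regFibre` types only the plaquette clause of [Balaban1985Variational] (2); print's regular space has the covariant-divergence clause
[Balaban1985RegularSpaces] (1.9) as well, and [Balaban1985Variational] Thm 1 is the minimum over that two-clause space).
`unitScaleTilt_unitTilt_of_regPr`: if, for every `L`, for all sufficiently small `ε₀ > 0`, eventually in the free top fraction `1/m`, for
every profile and all small `γ`, BOTH `T3PrintedRegularMinimiser.MinimiserStabilityRegPrAt F γ b₀ p₀ m ε₀` (two-cut-off consistency of the
actions of the minima of [Balaban1985Variational] Thm 1 over the space (6) in full) and `T3PrintedRegularMinimiser.FluctuationComparisonRegPrAt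
F γ b₀ p₀ m ε₀` (two-run comparison of [Balaban1985UV3] (41)'s fluctuation terms around exactly that background) hold, then `UnitTilt` —
`T3PrintedRegularMinimiser.unitTilt_shape_of_regPr`.  This is the glue a re-split of `UnitTilt` over the printed-regular twins would file
(`--glue-by`); NOT a proof of K1.
-/

noncomputable section

open Literature.MathematicalPhysics.QuantumFieldTheory.Balaban1983to89
open Literature.MathematicalPhysics.QuantumFieldTheory.Balaban1983to89.T3ContinuumYM3Torus
open Literature.MathematicalPhysics.QuantumFieldTheory.Balaban1983to89.T3PrintedRegularMinimiser
open Literature.MathematicalPhysics.QuantumFieldTheory.Balaban1983to89.T3PrintedRegularMinimiserReduction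
open Summit.QuantumFields.YangMills.Theses.UnitScaleTilt

namespace Summit.QuantumFields.YangMills.Theorems

/-- **K1 ⇐ THE PRINTED-REGULAR TWINS** (each «for all sufficiently small `ε₀`», eventually in `m`, below a threshold `γ₁(ε₀, m, b₀, p₀)`):
`MinimiserStabilityRegPr`-prefix → `FluctuationComparisonRegPr`-prefix → `UnitTilt`. -/
theorem unitScaleTilt_unitTilt_of_regPr
    (h₁ : ∀ L : ℕ, ∃ ε₁ : ℝ, 0 < ε₁ ∧ ∀ ε₀ : ℝ, 0 < ε₀ → ε₀ ≤ ε₁ → ∃ m₀ : ℕ, ∀ m : ℕ, m₀ ≤ m → ∀ b₀ p₀ : ℝ, 0 < b₀ → 2 < p₀ →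
      ∃ γ₁ : ℝ, 0 < γ₁ ∧ ∀ (F : T3Family) (γ : ℝ), F.L = L → 0 < γ → γ ≤ γ₁ → MinimiserStabilityRegPrAt F γ b₀ p₀ m ε₀)
    (h₂ : ∀ L : ℕ, ∃ ε₁ : ℝ, 0 < ε₁ ∧ ∀ ε₀ : ℝ, 0 < ε₀ → ε₀ ≤ ε₁ → ∃ m₀ : ℕ, ∀ m : ℕ, m₀ ≤ m → ∀ b₀ p₀ : ℝ, 0 < b₀ → 2 < p₀ →
      ∃ γ₁ : ℝ, 0 < γ₁ ∧ ∀ (F : T3Family) (γ : ℝ), F.L = L → 0 < γ → γ ≤ γ₁ → FluctuationComparisonRegPrAt F γ b₀ p₀ m ε₀) :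
    UnitTilt :=
  fun L => unitTilt_shape_of_regPr L (h₁ L) (h₂ L)

/-- **THE PLAQUETTE-ONLY TWINS' MINIMISER HALF ⇐ THE PRINTED ONE + G-K1aR-1** under K1's prefix: if, with the same quantifiers,
`MinimiserStabilityRegPrAt` holds AND the located gap `RegInfAgreeAt` (inf over the plaquette-only regular fibre = min over print's
two-clause space) holds, then the `MinimiserStabilityReg`-prefix of the pending children-v2 split holds — the exact sense in which the v2
child is «[7] Thm 1's object plus one unprinted statement». -/
theorem unitScaleTilt_minimiserStabilityReg_of_regPr
    (h₁ : ∀ L : ℕ, ∃ ε₁ : ℝ, 0 < ε₁ ∧ ∀ ε₀ : ℝ, 0 < ε₀ → ε₀ ≤ ε₁ → ∃ m₀ : ℕ, ∀ m : ℕ, m₀ ≤ m → ∀ b₀ p₀ : ℝ, 0 < b₀ → 2 < p₀ →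
      ∃ γ₁ : ℝ, 0 < γ₁ ∧ ∀ (F : T3Family) (γ : ℝ), F.L = L → 0 < γ → γ ≤ γ₁ →
        MinimiserStabilityRegPrAt F γ b₀ p₀ m ε₀ ∧ RegInfAgreeAt F γ b₀ p₀ m ε₀) :
    ∀ L : ℕ, ∃ ε₁ : ℝ, 0 < ε₁ ∧ ∀ ε₀ : ℝ, 0 < ε₀ → ε₀ ≤ ε₁ → ∃ m₀ : ℕ, ∀ m : ℕ, m₀ ≤ m → ∀ b₀ p₀ : ℝ, 0 < b₀ → 2 < p₀ →
      ∃ γ₁ : ℝ, 0 < γ₁ ∧ ∀ (F : T3Family) (γ : ℝ), F.L = L → 0 < γ → γ ≤ γ₁ →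
        T3RegularMinimiser.MinimiserStabilityRegAt F γ b₀ p₀ m ε₀ := by
  intro L
  obtain ⟨ε₁, hε₁, h⟩ := h₁ L
  refine ⟨ε₁, hε₁, fun ε₀ hε₀ hle => ?_⟩
  obtain ⟨m₀, hm⟩ := h ε₀ hε₀ hle
  refine ⟨m₀, fun m hmm b₀ p₀ hb hp => ?_⟩
  obtain ⟨γ₁, hγ₁, hF⟩ := hm m hmm b₀ p₀ hb hp
  refine ⟨γ₁, hγ₁, fun F γ hL hγ hγ₁' => ?_⟩
  obtain ⟨hst, hagree⟩ := hF F γ hL hγ hγ₁'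
  exact minimiserStabilityRegAt_of_regPr hγ.le hst hagree

end Summit.QuantumFields.YangMills.Theorems

end
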